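import Summits.HodgeConjecture.HodgeConjecture.Theorems.Ring2BindersAbelianSchemeVHCShadow
import Summits.HodgeConjecture.HodgeConjecture.Theorems.Ring2BindersAbelianSchemeVHCRaynaud
import Summits.HodgeConjecture.HodgeConjecture.Theorems.Ring2BindersAbelianSchemeVHCRungs
import HarnessLib

/-!
# Ring 2 — binder seat b02 (Hodge ladder stage 3): the HALVING of row b02 `AbelianSchemeVHC` — the binder IS its
# lower half `2p ≤ n`, modulo the print residual only; glued with the rungs, its content starts at `2 ≤ p ≤ n/2`, `n ≥ 4`

HONEST FRAMING: research route conditional on HC_CM; not a corollary; Q11.4-sentence-2 already refuted in dim ≥ 3.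

Cell `pub-hodge-ring2`, binder seat `ring2-b02`, row b02 of `BINDER-OWNERS.md` (`Ring2.Hypotheses.AbelianSchemeVHC`,
`Theorems/Ring2Hypotheses.lean`; OPEN, print-equivalent to `HC_AV`, nothing to discharge). `HC_CM`
(`Theses.RankFourFaces.CMAbelianHodge`) does not occur below; nothing here is a case of the Hodge conjecture; no
`sorry`, no definition, no NEW Literature fact, no node; «10 · 0» untouched.

WHAT THIS PART SETTLES. The rungs part (`Ring2BindersAbelianSchemeVHCRungs.lean`, p244633) proved fact-free that row b02
IS its restriction to relative dimension `n ≥ 4` and the middle range `2 ≤ p ≤ n - 2`, and left the HONEST LIMIT that the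
binder was NOT shown equivalent to its own LOWER half `2p ≤ n`. The shadow part
(`Ring2BindersAbelianSchemeVHCShadow.lean`) supplies the variational halving engine on carriers with quasi-projective
total space — a global class above the middle has a global LOWER SHADOW with the SAME algebraicity locus (one global
polarising class restricted from `ℙᴺ`, Deligne 1968 / Voisin II Thm. 4.18 with the identity principle, Lieberman's
`B(A)` through `A(𝒳_s, K|_{𝒳_s})`; fact-free). Part (v7) `Ring2BindersAbelianSchemeVHCNodes.lean` / the Raynaud part
reduce row b02 to its germ form on one-parameter abelian schemes with quasi-projective total space modulo the print
residual N97 `OneParameterAbelianSchemeQuasiProjective`, i.e. modulo Raynaud's theorem as booked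
(`Motives.raynaud1970_abelianScheme_section_projective`, G2 row c20). Hence, in the kernel:

* §1 `oneParameterAbelianSchemeVHCGerm_of_lowerHalf` — the LOWER HALF of row b02 already gives the germ form on
  one-parameter abelian schemes, FACT-FREE (their carriers are quasi-projective over an affine curve).
* §2 **`abelianSchemeVHC_iff_lowerHalf_of_oneParameterAbelianSchemeQuasiProjective`** /
  **`abelianSchemeVHC_iff_lowerHalf_of_raynaud1970`**: row b02 `AbelianSchemeVHC` ⟺ `AbelianSchemeVHCLowerHalf` (the row
  with the binder `2p ≤ n` inserted), modulo N97 / modulo c20 — the HONEST LIMIT of p244633 is CLOSED modulo print.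
* §3 glued with the rungs: **row b02 IS its restriction to relative dimension `n ≥ 4` and codimensions `2 ≤ p ≤ n/2`**
  (`abelianSchemeVHC_iff_lowerMiddleFrom_four_of_raynaud1970`; the cells `(4,2)`, `(5,2)`, `(6,2)`, `(6,3)`, …), and
  `HCUpToDim g ⟹ (row b02 ⟺ n ≥ g + 1, 2 ≤ p ≤ n/2)` (`abelianSchemeVHC_iff_lowerMiddleFrom_of_hcUpToDim`); so modulo
  {c20, c9 Moonen–Zarhin, c28 Markman} the binder's content starts at the two cells `(6, 2)`, `(6, 3)` (the rungs had
  `(6, 4)` too); and `HC_AV ⟺ AbelianSchemeVHCLowerMiddleFrom[4]` modulo {c11, c12, c20}, no `HC_CM`.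

What is NOT claimed: any case of `AbelianSchemeVHC` or of HC; anything about `HC_CM`; the residual (N97 / c20 are
HYPOTHESES wherever used, never asserted). The graded statements are FILE-LOCAL NOTATIONS, symbol for symbol the body
of `Ring2.Hypotheses.AbelianSchemeVHC` with binders inserted (`AbelianSchemeVHCUpTo[g]` verbatim the rungs part's, so
that its graded on-path lemma is consumed by name). Row b02 stays OPEN ≡ `HC_AV` modulo print.

References: [Grothendieck1966] footnote 13; [CharlesSchnell2014Notes] Conj. 11.3.1, Cor. 11.3.6, Prop. 11.3.11;
[VoisinHodgeI2002] Thm. 6.25, Rem. 6.27, Thm. 11.30; [VoisinHodgeII2003] Thm. 4.18, §10.2.3; [KerrPearlstein2011] §3.1;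
[Lieberman1968] main theorem; [GortzWedhorn2023] Thm. 27.291; [LaurentSchroer2023] Prop. 4.3; [Raynaud1970] XI 1.4
(not held, acq-09263); [MoonenZarhin1999LowDim] Thms. 0.1–0.2; [Markman2025SecantWeil] Cor. 1.6.1 (unrefereed);
[Andre1996Motifs] §6.3.
-/

-- every declaration of this problem lives in `Summit.HodgeConjecture.HodgeConjecture.…` (summit = sub-problem);
-- namespace `…Ring2.Binders` = the binder seats of the cell's Hodge-ladder stage 3 (`BINDER-OWNERS.md`)
set_option linter.dupNamespace false

noncomputable section

open CategoryTheory AlgebraicGeometry Topology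
open Literature.AlgebraicGeometry Literature.AlgebraicGeometry.Motives
open Literature.AlgebraicGeometry.HodgeTheory
open Literature.AlgebraicGeometry.Andre1996 (andre1996_cmAnchoredPencil
  andre1996_cmHodgeClasses_algebraicallyAnchoredPencils)

namespace Summit.HodgeConjecture.HodgeConjecture.Ring2.Binders

open Summit.HodgeConjecture.HodgeConjecture.Ring2.Hypotheses
open Summit.HodgeConjecture.HodgeConjecture.Ring2.ClassTargets

/-! ## §0 The graded statements (file-local notations; nothing is defined or asserted) -/

/-- Row b02 restricted to the LOWER HALF of codimensions `2p ≤ n` (file-local notation; symbol for symbol the body of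
`Ring2.Hypotheses.AbelianSchemeVHC` with the binder `2 * p ≤ n` inserted). -/
local notation3 (prettyPrint := false) "AbelianSchemeVHCLowerHalf" =>
  ∀ ⦃n : ℕ⦄ ⦃𝒳 S : SchemeOver ℂ⦄ (f : 𝒳 ⟶ S), IsSmoothProjectiveFamily f n → IrreducibleSpace S.left →
    AlgebraicGeometry.Smooth S.hom →
    (∀ s : ComplexPoints S, ∃ A' : AbelianVariety ℂ, A'.dim = n ∧ Nonempty (A'.X ≅ fiberOver f s)) →
    ∀ (p : ℕ), 2 * p ≤ n → ∀ (W : complexBetti 𝒳 (2 * p)),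
      (∀ s : ComplexPoints S, IsRationalClass (complexBetti.map (fiberι f s) (2 * p) W) ∧
        IsOfHodgeType n (fiberOver f s) (2 * p) p p (complexBetti.map (fiberι f s) (2 * p) W)) →
      (∃ s₀ : ComplexPoints S,
        complexBetti.map (fiberι f s₀) (2 * p) W ∈ algebraicClasses (fiberOver f s₀) p) →
      ∀ s : ComplexPoints S, complexBetti.map (fiberι f s) (2 * p) W ∈ algebraicClasses (fiberOver f s) p

/-- Row b02 restricted to relative dimension `n ≥ g` AND the lower middle range `2 ≤ p`, `2p ≤ n` (file-local
notation). -/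
local notation3 (prettyPrint := false) "AbelianSchemeVHCLowerMiddleFrom[" g "]" =>
  ∀ ⦃n : ℕ⦄ ⦃𝒳 S : SchemeOver ℂ⦄ (f : 𝒳 ⟶ S), IsSmoothProjectiveFamily f n → g ≤ n → IrreducibleSpace S.left →
    AlgebraicGeometry.Smooth S.hom →
    (∀ s : ComplexPoints S, ∃ A' : AbelianVariety ℂ, A'.dim = n ∧ Nonempty (A'.X ≅ fiberOver f s)) →
    ∀ (p : ℕ), 2 ≤ p → 2 * p ≤ n → ∀ (W : complexBetti 𝒳 (2 * p)),
      (∀ s : ComplexPoints S, IsRationalClass (complexBetti.map (fiberι f s) (2 * p) W) ∧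
        IsOfHodgeType n (fiberOver f s) (2 * p) p p (complexBetti.map (fiberι f s) (2 * p) W)) →
      (∃ s₀ : ComplexPoints S,
        complexBetti.map (fiberι f s₀) (2 * p) W ∈ algebraicClasses (fiberOver f s₀) p) →
      ∀ s : ComplexPoints S, complexBetti.map (fiberι f s) (2 * p) W ∈ algebraicClasses (fiberOver f s) p

/-- Row b02 restricted to relative dimension `n ≤ g` (file-local notation; verbatim the notation of the rungs part,
so that its graded on-path lemma `abelianSchemeVHC_upTo_of_hcUpToDim` is consumed by name). -/
local notation3 (prettyPrint := false) "AbelianSchemeVHCUpTo[" g "]" =>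
  ∀ ⦃n : ℕ⦄ ⦃𝒳 S : SchemeOver ℂ⦄ (f : 𝒳 ⟶ S), IsSmoothProjectiveFamily f n → n ≤ g → IrreducibleSpace S.left →
    AlgebraicGeometry.Smooth S.hom →
    (∀ s : ComplexPoints S, ∃ A' : AbelianVariety ℂ, A'.dim = n ∧ Nonempty (A'.X ≅ fiberOver f s)) →
    ∀ (p : ℕ) (W : complexBetti 𝒳 (2 * p)),
      (∀ s : ComplexPoints S, IsRationalClass (complexBetti.map (fiberι f s) (2 * p) W) ∧
        IsOfHodgeType n (fiberOver f s) (2 * p) p p (complexBetti.map (fiberι f s) (2 * p) W)) →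
      (∃ s₀ : ComplexPoints S,
        complexBetti.map (fiberι f s₀) (2 * p) W ∈ algebraicClasses (fiberOver f s₀) p) →
      ∀ s : ComplexPoints S, complexBetti.map (fiberι f s) (2 * p) W ∈ algebraicClasses (fiberOver f s) p

/-! ## §1 The lower half of row b02 gives the germ form on one-parameter abelian schemes, fact-free -/

/-- Restriction: row b02 gives its lower half (forget the binder `2p ≤ n`). [folklore] -/
theorem abelianSchemeVHCLowerHalf_of_abelianSchemeVHC (h : AbelianSchemeVHC) : AbelianSchemeVHCLowerHalf := by
  intro n 𝒳 S f hf hirr hsm habel p _ W hW h₀ s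
  exact h f hf hirr hsm habel p W hW h₀ s

/-- **The lower half of row b02 gives the germ form `OneParameterAbelianSchemeVHCGerm` — FACT-FREE** (the germ form's
carriers have quasi-projective total space and an affine, hence quasi-projective, curve base; the shadow part's
`map_fiberι_mem_algebraicClasses_of_lowerHalf` with `T = S(ℂ)`; the open set is all of `S(ℂ)`).
[cite: CharlesSchnell2014Notes, Conj. 11.3.1] [cite: VoisinHodgeII2003, Thm. 4.18] [cite: Lieberman1968, main theorem] -/
theorem oneParameterAbelianSchemeVHCGerm_of_lowerHalf (h : AbelianSchemeVHCLowerHalf) :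
    OneParameterAbelianSchemeVHCGerm := by
  intro n 𝒳 S f hf h𝒳 hirr haff hsm _ habel _ p W hW s₀ hs₀
  haveI := hirr
  haveI := haff
  haveI := hsm
  haveI : LocallyOfFiniteType S.hom := inferInstance
  refine ⟨Set.univ, isOpen_univ, Set.mem_univ _, fun s hs ↦ ?_⟩
  exact map_fiberι_mem_algebraicClasses_of_lowerHalf f hf h𝒳 (IsQuasiProjectiveOver.of_isAffine S) hsm habel
    Set.univ (fun q hq W' hW' h₀' t _ ↦ h f hf hirr hsm habel q hq W' hW' ⟨s₀, h₀'⟩ t) p W hW hs₀ s hs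

/-! ## §2 The binder: row b02 IS its lower half, modulo the print residual only -/

/-- **EXACTNESS modulo the curve print residual: row b02 `AbelianSchemeVHC` ⟺ its LOWER HALF** — the variational
Hodge conjecture for abelian schemes is its own restriction to codimensions `2p ≤ n`, granted only
`OneParameterAbelianSchemeQuasiProjective` (N97; used in `←`, through part (v7)'s
`abelianSchemeVHC_iff_germ_of_oneParameterAbelianSchemeQuasiProjective`). [cite: CharlesSchnell2014Notes, Conj. 11.3.1 and Prop. 11.3.11 (proof)]
[cite: VoisinHodgeII2003, Thm. 4.18] [cite: Lieberman1968, main theorem] [cite: GortzWedhorn2023, Thm. 27.291] -/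
theorem abelianSchemeVHC_iff_lowerHalf_of_oneParameterAbelianSchemeQuasiProjective
    (hqp : OneParameterAbelianSchemeQuasiProjective) : AbelianSchemeVHC ↔ AbelianSchemeVHCLowerHalf :=
  ⟨abelianSchemeVHCLowerHalf_of_abelianSchemeVHC, fun h ↦
    (abelianSchemeVHC_iff_germ_of_oneParameterAbelianSchemeQuasiProjective hqp).2
      (oneParameterAbelianSchemeVHCGerm_of_lowerHalf h)⟩

/-- **EXACTNESS modulo Raynaud's theorem as booked (`raynaud1970_abelianScheme_section_projective`, c20): row b02
⟺ its lower half.** CONDITIONAL on the named fact (used in `←` only). [cite: GortzWedhorn2023, §(27.53) Thm. 27.291]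
[cite: LaurentSchroer2023, §4 Prop. 4.3] [cite: CharlesSchnell2014Notes, Conj. 11.3.1] [cite: Lieberman1968, main theorem] -/
theorem abelianSchemeVHC_iff_lowerHalf_of_raynaud1970 (hR : raynaud1970_abelianScheme_section_projective) :
    AbelianSchemeVHC ↔ AbelianSchemeVHCLowerHalf :=
  abelianSchemeVHC_iff_lowerHalf_of_oneParameterAbelianSchemeQuasiProjective
    (oneParameterAbelianSchemeQuasiProjective_of_raynaud1970 hR)

/-! ## §3 Glued with the rungs: the content of row b02 starts at `n ≥ 4`, `2 ≤ p ≤ n/2` -/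

/-- **GLUING: a dimension slice `n ≤ g` and the lower middle range from `n ≥ g + 1` on give the lower half of row b02**
(off `2 ≤ p` the rungs' Lefschetz-range floor `abelianSchemeVHC_conclusion_of_lefschetzRange` concludes), unconditionally.
[cite: VoisinHodgeI2002, Thm. 6.25 and Thm. 11.30] -/
theorem abelianSchemeVHCLowerHalf_of_upTo_of_lowerMiddleFrom {g : ℕ} (h₁ : AbelianSchemeVHCUpTo[g])
    (h₂ : AbelianSchemeVHCLowerMiddleFrom[g + 1]) : AbelianSchemeVHCLowerHalf := by
  intro n 𝒳 S f hf hirr hsm habel p hpn W hW h₀ s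
  rcases Nat.lt_or_ge g n with hgn | hng
  · by_cases hp : p ≤ 1 ∨ n ≤ p + 1
    · exact abelianSchemeVHC_conclusion_of_lefschetzRange f hf hp W s (hW s)
    · exact h₂ f hf (by omega) hirr hsm habel p (by omega) hpn W hW h₀ s
  · exact h₁ f hf hng hirr hsm habel p W hW h₀ s

/-- Restriction: row b02 gives its lower middle range from any relative dimension `g` on. [folklore] -/
theorem abelianSchemeVHCLowerMiddleFrom_of_abelianSchemeVHC (g : ℕ) (h : AbelianSchemeVHC) :
    AbelianSchemeVHCLowerMiddleFrom[g] := by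
  intro n 𝒳 S f hf _ hirr hsm habel p _ _ W hW h₀ s
  exact h f hf hirr hsm habel p W hW h₀ s

/-- **`HCUpToDim g ⟹ (row b02 ⟺ its restriction to relative dimension `n ≥ g + 1`, codimensions `2 ≤ p ≤ n/2`)**,
modulo the curve print residual: the class target closes the slices `n ≤ g` (rungs §1
`abelianSchemeVHC_upTo_of_hcUpToDim`), the Lefschetz range closes `p ≤ 1`, the halving closes `2p > n`.
[cite: CharlesSchnell2014Notes, Cor. 11.3.6] [cite: KerrPearlstein2011, §3.1] [cite: Lieberman1968, main theorem] -/
theorem abelianSchemeVHC_iff_lowerMiddleFrom_of_hcUpToDim (hqp : OneParameterAbelianSchemeQuasiProjective) {g : ℕ}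
    (h : HCUpToDim g) : AbelianSchemeVHC ↔ AbelianSchemeVHCLowerMiddleFrom[g + 1] :=
  ⟨abelianSchemeVHCLowerMiddleFrom_of_abelianSchemeVHC (g + 1), fun h₂ ↦
    (abelianSchemeVHC_iff_lowerHalf_of_oneParameterAbelianSchemeQuasiProjective hqp).2
      (abelianSchemeVHCLowerHalf_of_upTo_of_lowerMiddleFrom (abelianSchemeVHC_upTo_of_hcUpToDim h) h₂)⟩

/-- **Row b02 IS its restriction to families of abelian varieties of relative dimension `n ≥ 4` and codimensions
`2 ≤ p ≤ n/2`**, modulo the curve print residual (the slices `n ≤ 3` are the rungs' unconditional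
`abelianSchemeVHC_upTo_three`). First cells with content: `(4, 2)`, `(5, 2)`, `(6, 2)`, `(6, 3)`, ….
[cite: VoisinHodgeII2003, §10.2.3 proof of Prop. 10.26] [cite: KerrPearlstein2011, §3.1] [cite: Lieberman1968, main theorem] -/
theorem abelianSchemeVHC_iff_lowerMiddleFrom_four_of_oneParameterAbelianSchemeQuasiProjective
    (hqp : OneParameterAbelianSchemeQuasiProjective) : AbelianSchemeVHC ↔ AbelianSchemeVHCLowerMiddleFrom[4] :=
  ⟨abelianSchemeVHCLowerMiddleFrom_of_abelianSchemeVHC 4, fun h₂ ↦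
    (abelianSchemeVHC_iff_lowerHalf_of_oneParameterAbelianSchemeQuasiProjective hqp).2
      (abelianSchemeVHCLowerHalf_of_upTo_of_lowerMiddleFrom abelianSchemeVHC_upTo_three h₂)⟩

/-- The same modulo Raynaud's theorem as booked (c20). CONDITIONAL on the named fact (used in `←` only).
[cite: GortzWedhorn2023, §(27.53) Thm. 27.291] [cite: KerrPearlstein2011, §3.1] [cite: Lieberman1968, main theorem] -/
theorem abelianSchemeVHC_iff_lowerMiddleFrom_four_of_raynaud1970 (hR : raynaud1970_abelianScheme_section_projective) :
    AbelianSchemeVHC ↔ AbelianSchemeVHCLowerMiddleFrom[4] :=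
  abelianSchemeVHC_iff_lowerMiddleFrom_four_of_oneParameterAbelianSchemeQuasiProjective
    (oneParameterAbelianSchemeQuasiProjective_of_raynaud1970 hR)

/-- **Modulo Raynaud (c20), Markman's Weil-fourfold claim (c28) and Moonen–Zarhin (c9), row b02 IS its restriction to
relative dimension `n ≥ 6` and codimensions `2 ≤ p ≤ n/2`**: the first cells of the binder not covered are
`(n, p) = (6, 2)` and `(6, 3)` (the rungs had `(6, 4)` as well). All three inputs displayed as hypotheses.
[cite: MoonenZarhin1999LowDim, Thms. 0.1–0.2] [cite: Markman2025SecantWeil, Cor. 1.6.1 (unrefereed)]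
[cite: GortzWedhorn2023, Thm. 27.291] [cite: Lieberman1968, main theorem] -/
theorem abelianSchemeVHC_iff_lowerMiddleFrom_six_of_weilClassesFourfolds_of_moonenZarhin_of_raynaud1970
    (hR : raynaud1970_abelianScheme_section_projective) (hW : Markman2025_weilClasses_algebraic_abelianFourfold)
    (hMZ : MoonenZarhin1999_hodgeClasses_abelian_dim_le_five_of_weilClassesFourfolds) :
    AbelianSchemeVHC ↔ AbelianSchemeVHCLowerMiddleFrom[6] :=
  abelianSchemeVHC_iff_lowerMiddleFrom_of_hcUpToDim (oneParameterAbelianSchemeQuasiProjective_of_raynaud1970 hR)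
    (hcUpToDim_five_of_weilClassesFourfolds_of_moonenZarhin hW hMZ)

/-- The same granted the support item `HodgeAbelianDimLeFive` of route `SevenfoldWeilCensus` (stmt-HodgeConjecture-18723)
by name, modulo Raynaud (c20). [cite: Markman2025SurveySecant, Cor. 1.3 (unrefereed)] [cite: GortzWedhorn2023, Thm. 27.291] -/
theorem abelianSchemeVHC_iff_lowerMiddleFrom_six_of_hodgeAbelianDimLeFive_of_raynaud1970
    (hR : raynaud1970_abelianScheme_section_projective) (h₅ : Theses.SevenfoldWeilCensus.HodgeAbelianDimLeFive) :
    AbelianSchemeVHC ↔ AbelianSchemeVHCLowerMiddleFrom[6] :=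
  abelianSchemeVHC_iff_lowerMiddleFrom_of_hcUpToDim (oneParameterAbelianSchemeQuasiProjective_of_raynaud1970 hR)
    (hcUpToDim_five_iff_hodgeAbelianDimLeFive.mpr h₅)

/-- **`HC_AV` ⟺ the lower middle of row b02 from relative dimension `4` on**, modulo André 1996 #21/#22 (c11, c12) and
Raynaud (c20): deform IV's (E₂′) `Deform.HC_AV_iff_abelianSchemeVHC_of_andre1996` composed with the halving. No `HC_CM`.
[cite: Andre1996Motifs, §6.3 Lemmes 6.3.1–6.3.3] [cite: KerrPearlstein2011, §3.1] [cite: Lieberman1968, main theorem] -/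
theorem hc_av_iff_abelianSchemeVHCLowerMiddleFrom_four_of_andre1996_of_raynaud1970
    (h₂₁ : andre1996_cmAnchoredPencil) (h₂₂ : andre1996_cmHodgeClasses_algebraicallyAnchoredPencils)
    (hR : raynaud1970_abelianScheme_section_projective) :
    Theses.PadicSemiregularLift.HodgeAbelianVarieties ↔ AbelianSchemeVHCLowerMiddleFrom[4] :=
  (Deform.HC_AV_iff_abelianSchemeVHC_of_andre1996 h₂₁ h₂₂).trans
    (abelianSchemeVHC_iff_lowerMiddleFrom_four_of_raynaud1970 hR)

/-! ## Audit: what the kernel now says about row b02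

`AbelianSchemeVHCLowerHalf → OneParameterAbelianSchemeVHCGerm` FACT-FREE (§1); `AbelianSchemeVHC ↔ AbelianSchemeVHCLowerHalf`
and `↔ AbelianSchemeVHCLowerMiddleFrom[4]` modulo N97 / c20 displayed as hypotheses (§2–§3); `HC_CM` does not occur; route
items and the facts c9, c11, c12, c28 enter by name as hypotheses only. Closures below are the three standard axioms. -/

#print axioms Summit.HodgeConjecture.HodgeConjecture.Ring2.Binders.oneParameterAbelianSchemeVHCGerm_of_lowerHalf
#print axioms Summit.HodgeConjecture.HodgeConjecture.Ring2.Binders.abelianSchemeVHC_iff_lowerHalf_of_raynaud1970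
#print axioms Summit.HodgeConjecture.HodgeConjecture.Ring2.Binders.abelianSchemeVHC_iff_lowerMiddleFrom_four_of_raynaud1970
#print axioms Summit.HodgeConjecture.HodgeConjecture.Ring2.Binders.hc_av_iff_abelianSchemeVHCLowerMiddleFrom_four_of_andre1996_of_raynaud1970

end Summit.HodgeConjecture.HodgeConjecture.Ring2.Binders

end
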